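import Mathlib
import HarnessLib
import Literature.Analysis.FluidPDE.ElgindiBlowup
import Literature.Analysis.FluidPDE.SwirlCutoff
import Summits.NavierStokesRegularity.NavierStokesRegularity.Theorems.AxisTwistDoorAveragedConeLiouvilleCylFrame
import Summits.NavierStokesRegularity.NavierStokesRegularity.Theorems.AxisTwistDoorAveragedConeLiouvilleCircleToolkit
import Summits.NavierStokesRegularity.NavierStokesRegularity.Theorems.HalfSpaceWindowDoorCirculationCarryingRigidityTimeOnlyVEquation
import Summits.NavierStokesRegularity.NavierStokesRegularity.Theorems.HalfSpaceWindowDoorCirculationCarryingRigidityWholeSpaceMaxPrinciple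
import Summits.NavierStokesRegularity.NavierStokesRegularity.Theorems.HalfSpaceWindowDoorCirculationCarryingRigidityEddyTorqueOneSidedLiouville
import Summits.NavierStokesRegularity.NavierStokesRegularity.Theorems.PoloidalWindowDoorPoloidalWindowRigidityLargeScaleEnergyBootstrapLevels

/-!
# Route `HalfSpaceWindowDoor`, crux `CirculationCarryingRigidity` (stmt-NavierStokesRegularity-25311) — FIRST CENSUS THEOREM
# IN THE TIME-ONLY CLASS: mean outflow with eddy spin-down forces a poloidal profile

Line `eddy_torque` (LEAD ns-hsw-p1 g5).  Every census theorem of this crux so far (g3 `…TiltDominatedLiouville`,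
`…AxisTypeILiouville`; g4 `…EddyTorqueLiouville`; g5 `…EddyTorqueOneSidedLiouville`, `…EddyTiltTorque`) assumes the
AXIS-TYPE-I bound `‖v(x,t)‖ ≤ D/(|x_h| + √(−t))`, under which the axis circulation `Γ ≤ 2πD` is bounded.  The door class of
the crux only provides `‖v(·,t)‖ ≤ C/√(−t)`; there `Γ ≤ 2πrC/√(−s)` is unbounded and the KNSS machinery does not apply.
This file proves the first rigidity statement in the door class itself:

  **Theorem** (`inner_curl_e3_eq_zero_of_remainder_le_outflow`).  Let `v` be a door-class profile (Type-I time decay,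
  continuity, the mild identity, divergence-free) with `ω₃ ≥ 0`, and suppose the eddy torque of the circle law
  (`…AngularMeanDrift.deriv_circ_s_eq_remainder`) obeys, on every axis circle `r > 0` at every `s < 0`,
      `ℛ(r,z,s) ≤ (1 + r·v̄_r(r,z,s)) · Γ(r,z,s)/r²`.
  Then `ω₃ ≡ 0`: the profile is poloidal.
  In particular (`…_of_outflow_spinDown`) mean OUTFLOW `v̄_r ≥ 0` together with eddy SPIN-DOWN `ℛ ≤ 0` forces `ω₃ ≡ 0`.

Proof.  The mean swirl velocity `V = Γ/(2πr) = v̄_θ` satisfies `0 ≤ V ≤ C/√(−s)` (sign + class bound), is jointly continuous up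
to the axis (where `Γ = O(r²)` by Stokes and the class gradient rate), and off the axis obeys
`∂ₛV + ⟨v⟩_θ·∇V − ΔV = (2πr)⁻¹(ℛ − v̄_rΓ/r − Γ/r²) ≤ 0` (`…TimeOnlyVEquation.V_subsolution`) with the bounded drift
`‖⟨v⟩_θ‖ ≤ C/√(−s)`.  The whole-space maximum principle (`…WholeSpaceMaxPrinciple.le_of_subsolution`, hypotheses only on
`{V > m}`, which avoids the axis since `m ≥ 0 = V|_{axis}`) on `[s₀, t]` gives `V(t,·) ≤ C/√(−s₀) → 0` as `s₀ → −∞`.  Hence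
`V ≡ 0`, `Γ ≡ 0`, and `…EddyTorqueOneSidedLiouville.poloidal_of_circF_eq_zero` concludes.

All statements concern HYPOTHETICAL blow-up profiles; nothing here is a regularity claim for Navier–Stokes.  The crux itself
(no eddy-torque hypothesis) stays open.
-/

set_option linter.dupNamespace false
set_option autoImplicit false

namespace Summit.NavierStokesRegularity.NavierStokesRegularity.Theorems.HalfSpaceWindowDoorCirculationCarryingRigidityTimeOnlyOutflow

open Set Filter Topology Function
open scoped Laplacian RealInnerProductSpace ContDiff Classical
open Literature.Analysis Literature.Analysis.FluidPDE
open Summit.NavierStokesRegularity.NavierStokesRegularity.Theorems.AxisTwistDoorAveragedConeLiouvilleDefs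
  (cylPt eT e3 circ vortCirc radVortCirc meanR meanZ remainder SignE3)
open Summit.NavierStokesRegularity.NavierStokesRegularity.Theorems.AveragedConeLiouville.CircMonotone
  (circ_nonneg circ_eq_integral_vortCirc)
open Summit.NavierStokesRegularity.NavierStokesRegularity.Theorems.AxisTwistDoorAveragedConeLiouvilleCylFrame (abs_inner_e3_le)
open Summit.NavierStokesRegularity.NavierStokesRegularity.Theorems.AxisTwistDoorAveragedConeLiouvilleCircleToolkit (abs_circ_le)
open Summit.NavierStokesRegularity.NavierStokesRegularity.Theorems.HalfSpaceWindowDoorCirculationCarryingRigidityAxisCirculation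
open Summit.NavierStokesRegularity.NavierStokesRegularity.Theorems.HalfSpaceWindowDoorCirculationCarryingRigidityTimeOnlyVEquation
  (hasDerivAt_V_time V_subsolution)
open Summit.NavierStokesRegularity.NavierStokesRegularity.Theorems.HalfSpaceWindowDoorCirculationCarryingRigidityWholeSpaceMaxPrinciple
  (le_of_subsolution)
open Summit.NavierStokesRegularity.NavierStokesRegularity.Theorems.HalfSpaceWindowDoorCirculationCarryingRigidityEddyTorqueOneSidedLiouville
  (poloidal_of_circF_eq_zero)
open Summit.NavierStokesRegularity.NavierStokesRegularity.Theorems.PoloidalWindowDoorPoloidalWindowRigidityClassSpaceTimeRates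
  (exists_fderiv_rate_of_class')
open Summit.NavierStokesRegularity.NavierStokesRegularity.Theorems.PoloidalWindowDoorPoloidalWindowRigidityLargeScaleEnergyBootstrapLevels
  (typeI_const_nonneg)

variable {C K : ℝ} {v : ℝ → EuclideanSpace ℝ (Fin 3) → EuclideanSpace ℝ (Fin 3)}

/-! ### Size of `V = Γ/(2πr)`: the class bound and the quadratic axis bound -/

/-- **`V ≤ C/√(−s)`**: the mean swirl velocity obeys the class bound (`|Γ| ≤ 2πr·C/√(−s)`). -/
theorem V_le (hrate : HasTypeITimeDecay C v) {σ : ℝ} (hσ : σ < 0) (y : EuclideanSpace ℝ (Fin 3)) :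
    (2 * Real.pi)⁻¹ * circ v (cylRadius y) (y 2) σ / cylRadius y ≤ C / Real.sqrt (-σ) := by
  have hC := typeI_const_nonneg hrate
  by_cases hy : cylRadius y = 0
  · rw [hy, div_zero]
    positivity
  have hr : 0 < cylRadius y := lt_of_le_of_ne (cylRadius_nonneg y) (Ne.symm hy)
  have hΓ : circ v (cylRadius y) (y 2) σ ≤ 2 * Real.pi * cylRadius y * (C / Real.sqrt (-σ)) :=
    (le_abs_self _).trans (abs_circ_le hr fun θ => hrate σ hσ _)
  calc (2 * Real.pi)⁻¹ * circ v (cylRadius y) (y 2) σ / cylRadius y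
        = ((2 * Real.pi)⁻¹ * (cylRadius y)⁻¹) * circ v (cylRadius y) (y 2) σ := by ring
    _ ≤ ((2 * Real.pi)⁻¹ * (cylRadius y)⁻¹) * (2 * Real.pi * cylRadius y * (C / Real.sqrt (-σ))) :=
        mul_le_mul_of_nonneg_left hΓ (by positivity)
    _ = C / Real.sqrt (-σ) := by field_simp

/-- **`V ≥ 0`** under the sign `ω₃ ≥ 0`. -/
theorem V_nonneg (hsm : IsSmoothSpaceTimeOn (Iio (0 : ℝ)) v) (hsign : SignE3 v) {σ : ℝ} (hσ : σ < 0)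
    (y : EuclideanSpace ℝ (Fin 3)) :
    0 ≤ (2 * Real.pi)⁻¹ * circ v (cylRadius y) (y 2) σ / cylRadius y := by
  have hv1 : ContDiff ℝ 1 (v σ) := (hsm.contDiff_slice hσ).of_le (by norm_cast)
  have h := circ_nonneg (v := v) hv1 hsign hσ (cylRadius_nonneg y) (y 2)
  have := cylRadius_nonneg y
  positivity

/-- **Quadratic axis bound**: `|Γ(r,z,s)| ≤ 8π K' r²` when `‖∇v(s)‖ ≤ K'` (Stokes `Γ = ∫₀^r ∮ω₃`, `|ω| ≤ 4‖∇v‖`). -/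
theorem abs_circ_le_sq {σ K' : ℝ} (hv1 : ContDiff ℝ 1 (v σ)) (hK : ∀ y, ‖fderiv ℝ (v σ) y‖ ≤ K')
    {r : ℝ} (hr : 0 ≤ r) (z : ℝ) :
    |circ v r z σ| ≤ 4 * K' * r * |2 * Real.pi - 0| * |r - 0| := by
  rw [circ_eq_integral_vortCirc v hv1 z r, ← Real.norm_eq_abs]
  refine intervalIntegral.norm_integral_le_of_norm_le_const fun ρ hρ => ?_
  rw [uIoc_of_le hr] at hρ
  obtain ⟨h0, hρr⟩ := hρ
  unfold vortCirc
  refine intervalIntegral.norm_integral_le_of_norm_le_const fun θ _ => ?_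
  rw [Real.norm_eq_abs, abs_mul, abs_of_nonneg h0.le]
  have hK0 : 0 ≤ K' := (norm_nonneg _).trans (hK 0)
  calc |inner ℝ (curl (v σ) (cylPt ρ θ z)) e3| * ρ ≤ ‖curl (v σ) (cylPt ρ θ z)‖ * r :=
        mul_le_mul (abs_inner_e3_le _) hρr h0.le (norm_nonneg _)
    _ ≤ 4 * K' * r := by
        have h4 := (norm_curl_le_four_mul (v σ) (cylPt ρ θ z)).trans (mul_le_mul_of_nonneg_left (hK _) (by norm_num))
        exact mul_le_mul_of_nonneg_right h4 hr

/-- **`|V| ≤ 8πK'·|x_h|`** near and on the axis when `‖∇v(s)‖ ≤ K'`. -/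
theorem abs_V_le_mul_cylRadius {σ K' : ℝ} (hv1 : ContDiff ℝ 1 (v σ)) (hK : ∀ y, ‖fderiv ℝ (v σ) y‖ ≤ K')
    (y : EuclideanSpace ℝ (Fin 3)) :
    |(2 * Real.pi)⁻¹ * circ v (cylRadius y) (y 2) σ / cylRadius y| ≤
      (2 * Real.pi)⁻¹ * (4 * K' * |2 * Real.pi - 0|) * cylRadius y := by
  have hK0 : 0 ≤ K' := (norm_nonneg _).trans (hK 0)
  by_cases hy : cylRadius y = 0
  · rw [hy, div_zero, abs_zero, mul_zero]
  have hr : 0 < cylRadius y := lt_of_le_of_ne (cylRadius_nonneg y) (Ne.symm hy)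
  have h := abs_circ_le_sq hv1 hK hr.le (y 2)
  rw [sub_zero (cylRadius y), abs_of_pos hr] at h
  rw [abs_div, abs_mul, abs_of_pos hr, abs_of_pos (by positivity : (0 : ℝ) < (2 * Real.pi)⁻¹), div_le_iff₀ hr]
  calc (2 * Real.pi)⁻¹ * |circ v (cylRadius y) (y 2) σ|
        ≤ (2 * Real.pi)⁻¹ * (4 * K' * cylRadius y * |2 * Real.pi - 0| * cylRadius y) :=
        mul_le_mul_of_nonneg_left h (by positivity)
    _ = (2 * Real.pi)⁻¹ * (4 * K' * |2 * Real.pi - 0|) * cylRadius y * cylRadius y := by ring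

/-! ### Joint continuity of `V` up to the axis on closed time slabs -/

/-- **`V` is jointly continuous on `[s₀,s₁] × ℝ³`** (`s₁ < 0`), the axis included, given the class gradient rate
`‖∇v(t)‖ ≤ K/(−t)`. -/
theorem continuousOn_V (hsm : IsSmoothSpaceTimeOn (Iio (0 : ℝ)) v) (hK0 : 0 ≤ K)
    (hK : ∀ t < 0, ∀ y, ‖fderiv ℝ (v t) y‖ ≤ K / (-t)) {s₀ s₁ : ℝ} (hs₁ : s₁ < 0) :
    ContinuousOn (uncurry fun σ (y : EuclideanSpace ℝ (Fin 3)) =>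
      (2 * Real.pi)⁻¹ * circ v (cylRadius y) (y 2) σ / cylRadius y) (Icc s₀ s₁ ×ˢ univ) := by
  have hFc : ContinuousOn (uncurry fun σ (y : EuclideanSpace ℝ (Fin 3)) =>
      (2 * Real.pi)⁻¹ * circ v (cylRadius y) (y 2) σ) (Iio (0 : ℝ) ×ˢ univ) :=
    (isSmoothSpaceTimeOn_circF hsm).continuousOn
  intro p hp
  have hp1 : p.1 < 0 := lt_of_le_of_lt (mem_Icc.1 (mem_prod.1 hp).1).2 hs₁
  by_cases hax : cylRadius p.2 = 0
  · -- an axis point: `|V(σ,y)| ≤ M·|y_h| → 0`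
    set M : ℝ := (2 * Real.pi)⁻¹ * (4 * (K / (-s₁)) * |2 * Real.pi - 0|) with hM
    have hval : (uncurry fun σ (y : EuclideanSpace ℝ (Fin 3)) =>
        (2 * Real.pi)⁻¹ * circ v (cylRadius y) (y 2) σ / cylRadius y) p = 0 := by
      show (2 * Real.pi)⁻¹ * circ v (cylRadius p.2) (p.2 2) p.1 / cylRadius p.2 = 0
      rw [hax, div_zero]
    show Tendsto _ _ _
    rw [hval]
    have hev : ∀ᶠ q in 𝓝[Icc s₀ s₁ ×ˢ univ] p, ‖(uncurry fun σ (y : EuclideanSpace ℝ (Fin 3)) =>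
        (2 * Real.pi)⁻¹ * circ v (cylRadius y) (y 2) σ / cylRadius y) q‖ ≤ M * cylRadius q.2 := by
      refine eventually_nhdsWithin_of_forall fun q hq => ?_
      have hq1 : q.1 ≤ s₁ := (mem_Icc.1 (mem_prod.1 hq).1).2
      have hq0 : q.1 < 0 := lt_of_le_of_lt hq1 hs₁
      have hv1 : ContDiff ℝ 1 (v q.1) := (hsm.contDiff_slice hq0).of_le (by norm_cast)
      have hK' : ∀ y, ‖fderiv ℝ (v q.1) y‖ ≤ K / (-s₁) := fun y =>
        (hK q.1 hq0 y).trans (div_le_div_of_nonneg_left hK0 (by linarith) (by linarith))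
      rw [Real.norm_eq_abs]
      exact abs_V_le_mul_cylRadius hv1 hK' q.2
    refine squeeze_zero_norm' hev ?_
    have hc : Continuous fun q : ℝ × EuclideanSpace ℝ (Fin 3) => M * cylRadius q.2 :=
      continuous_const.mul (continuous_cylRadius.comp continuous_snd)
    have h := (hc.tendsto p).mono_left (nhdsWithin_le_nhds (s := Icc s₀ s₁ ×ˢ univ))
    rwa [hax, mul_zero] at h
  · -- off the axis: quotient of continuous functions
    have hFp : ContinuousAt (uncurry fun σ (y : EuclideanSpace ℝ (Fin 3)) =>
        (2 * Real.pi)⁻¹ * circ v (cylRadius y) (y 2) σ) p :=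
      hFc.continuousAt ((isOpen_Iio.prod isOpen_univ).mem_nhds (mem_prod.2 ⟨hp1, mem_univ _⟩))
    have hr : ContinuousAt (fun q : ℝ × EuclideanSpace ℝ (Fin 3) => cylRadius q.2) p :=
      (continuous_cylRadius.comp continuous_snd).continuousAt
    exact (hFp.div hr hax).continuousWithinAt

/-! ### The census theorem -/

/-- **`V ≤ 0` by the maximum principle and decay in the far past.**  Door class + the eddy-torque hypothesis
`ℛ ≤ (1 + r v̄_r)Γ/r²` on all axis circles ⇒ `V(t,x) ≤ 0` for all `t < 0` (no sign hypothesis is needed for this half: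
the region `{V > m}`, `m ≥ 0`, avoids the axis by itself). -/
theorem V_nonpos (hrate : HasTypeITimeDecay C v)
    (hcont : ContinuousOn (uncurry v) (Iio (0 : ℝ) ×ˢ univ))
    (hmild : ∀ s t : ℝ, s < t → t < 0 → ∀ x,
      v t x = UnboundedOperators.heatExtension (v s) (t - s) x - oseenDuhamel 1 s v v t x)
    (hdiv : ∀ t < 0, VectorCalculus.IsDivFree (v t))
    (hrem : ∀ s < 0, ∀ r : ℝ, 0 < r → ∀ z : ℝ,
      remainder v r z s ≤ (1 + r * meanR v r z s) * circ v r z s / r ^ 2)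
    {t : ℝ} (ht : t < 0) (x : EuclideanSpace ℝ (Fin 3)) :
    (2 * Real.pi)⁻¹ * circ v (cylRadius x) (x 2) t / cylRadius x ≤ 0 := by
  have hsm : IsSmoothSpaceTimeOn (Iio (0 : ℝ)) v := isSmoothSpaceTimeOn_of_class hrate hcont hmild hdiv
  have hC := typeI_const_nonneg hrate
  obtain ⟨K, hK0, hK⟩ := exists_fderiv_rate_of_class' hrate hcont hmild
  -- the maximum principle on `[s₀, t]` for every `s₀ < t`
  have hmp : ∀ s₀ < t, (2 * Real.pi)⁻¹ * circ v (cylRadius x) (x 2) t / cylRadius x ≤ C / Real.sqrt (-s₀) := by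
    intro s₀ hs₀
    have hΛ : 0 ≤ C / Real.sqrt (-t) := by positivity
    refine le_of_subsolution (q := fun σ (y : EuclideanSpace ℝ (Fin 3)) =>
        (2 * Real.pi)⁻¹ * circ v (cylRadius y) (y 2) σ / cylRadius y)
      (b := fun σ y => angularMeanVec (v σ) y) (B := C / Real.sqrt (-t)) hΛ
      (continuousOn_V hsm hK0 hK ht) ?_ ?_ ?_ t (right_mem_Icc.2 hs₀.le) x
    · intro σ hσ y
      have hσ0 : σ < 0 := lt_of_le_of_lt hσ.2 ht
      refine (V_le hrate hσ0 y).trans (div_le_div_of_nonneg_left hC (Real.sqrt_pos.2 (by linarith)) ?_)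
      exact Real.sqrt_le_sqrt (by linarith [hσ.2])
    · intro y
      exact V_le hrate (by linarith) y
    · intro σ hσ y hmy
      have hσ0 : σ < 0 := lt_of_le_of_lt hσ.2 ht
      have hm0 : 0 ≤ C / Real.sqrt (-s₀) := by positivity
      have hy : cylRadius y ≠ 0 := by
        intro h0
        rw [h0, div_zero] at hmy
        exact absurd hmy (not_lt.2 hm0)
      have hr : 0 < cylRadius y := lt_of_le_of_ne (cylRadius_nonneg y) (Ne.symm hy)
      refine ⟨?_, ?_, ?_⟩
      · -- the drift bound `‖⟨v⟩_θ‖ ≤ C/√(−σ) ≤ C/√(−t)`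
        have h1 : ‖angularMeanVec (v σ) y‖ ≤ C / Real.sqrt (-σ) :=
          norm_angularMeanVec_le (b := fun _ => C / Real.sqrt (-σ)) (fun x' => hrate σ hσ0 x') y
        refine h1.trans (div_le_div_of_nonneg_left hC (Real.sqrt_pos.2 (by linarith)) ?_)
        exact Real.sqrt_le_sqrt (by linarith [hσ.2])
      · -- local `C²` regularity off the axis
        refine ⟨{y' | cylRadius y / 2 < cylRadius y'}, isOpen_lt continuous_const continuous_cylRadius,
          by show cylRadius y / 2 < cylRadius y; linarith, ?_⟩
        have hF : ContDiff ℝ 2 fun y' : EuclideanSpace ℝ (Fin 3) => (2 * Real.pi)⁻¹ * circ v (cylRadius y') (y' 2) σ :=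
          contDiff_circF ((hsm.contDiff_slice hσ0).of_le (by norm_cast))
        refine hF.contDiffOn.div (fun y' hy' => ?_) fun y' hy' => ?_
        · have hy'0 : cylRadius y' ≠ 0 := by
            have : cylRadius y / 2 < cylRadius y' := hy'
            exact ne_of_gt (by linarith [cylRadius_nonneg y])
          exact (contDiffAt_cylRadius hy'0).contDiffWithinAt
        · have : cylRadius y / 2 < cylRadius y' := hy'
          exact ne_of_gt (by linarith [cylRadius_nonneg y])
      · -- the subsolution inequality
        exact ⟨_, (hasDerivAt_V_time hsm hσ0 y).differentiableAt.hasDerivAt,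
          V_subsolution hrate hcont hmild hdiv hσ0 hy (hrem σ hσ0 (cylRadius y) hr (y 2))⟩
  -- let `s₀ → −∞`
  have hlim : Tendsto (fun s₀ : ℝ => C / Real.sqrt (-s₀)) atBot (𝓝 0) := by
    have h1 : Tendsto (fun s₀ : ℝ => Real.sqrt (-s₀)) atBot atTop :=
      Real.tendsto_sqrt_atTop.comp tendsto_neg_atBot_atTop
    have h2 := h1.inv_tendsto_atTop
    have h3 := h2.const_mul C
    rw [mul_zero] at h3
    refine h3.congr fun s₀ => ?_
    simp [div_eq_mul_inv]
  exact ge_of_tendsto hlim ((eventually_lt_atBot t).mono fun s₀ hs₀ => hmp s₀ hs₀)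

/-- **FIRST CENSUS THEOREM IN THE TIME-ONLY CLASS.**  A door-class profile (`‖v(·,t)‖ ≤ C/√(−t)`, continuity, the mild
identity, divergence-free) with `ω₃ ≥ 0` whose eddy torque obeys `ℛ(r,z,s) ≤ (1 + r v̄_r(r,z,s))·Γ(r,z,s)/r²` on every axis
circle (`r > 0`, `s < 0`) is POLOIDAL: `ω₃ ≡ 0`.  (No axis-Type-I bound is assumed.) -/
theorem inner_curl_e3_eq_zero_of_remainder_le_outflow (C : ℝ)
    (v : ℝ → EuclideanSpace ℝ (Fin 3) → EuclideanSpace ℝ (Fin 3))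
    (hrate : HasTypeITimeDecay C v)
    (hcont : ContinuousOn (uncurry v) (Iio (0 : ℝ) ×ˢ univ))
    (hmild : ∀ s t : ℝ, s < t → t < 0 → ∀ x,
      v t x = UnboundedOperators.heatExtension (v s) (t - s) x - oseenDuhamel 1 s v v t x)
    (hdiv : ∀ t < 0, VectorCalculus.IsDivFree (v t))
    (hsign : ∀ s < 0, ∀ y, 0 ≤ inner ℝ (curl (v s) y) (EuclideanSpace.single (2 : Fin 3) (1 : ℝ)))
    (hrem : ∀ s < 0, ∀ r : ℝ, 0 < r → ∀ z : ℝ,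
      remainder v r z s ≤ (1 + r * meanR v r z s) * circ v r z s / r ^ 2) :
    ∀ s < 0, ∀ y, inner ℝ (curl (v s) y) (EuclideanSpace.single (2 : Fin 3) (1 : ℝ)) = 0 := by
  have hsm : IsSmoothSpaceTimeOn (Iio (0 : ℝ)) v := isSmoothSpaceTimeOn_of_class hrate hcont hmild hdiv
  have hsign' : SignE3 v := hsign
  have hF0 : ∀ t < 0, ∀ x : EuclideanSpace ℝ (Fin 3), (2 * Real.pi)⁻¹ * circ v (cylRadius x) (x 2) t = 0 := by
    intro t ht x
    by_cases hx : cylRadius x = 0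
    · exact circF_axis v t hx
    have hr : 0 < cylRadius x := lt_of_le_of_ne (cylRadius_nonneg x) (Ne.symm hx)
    have hV := V_nonpos hrate hcont hmild hdiv hrem ht x
    have hV0 := V_nonneg hsm hsign' ht x
    have hVz : (2 * Real.pi)⁻¹ * circ v (cylRadius x) (x 2) t / cylRadius x = 0 := le_antisymm hV hV0
    rcases div_eq_zero_iff.1 hVz with h | h
    · exact h
    · exact absurd h hx
  exact poloidal_of_circF_eq_zero hrate hcont hmild hdiv hsign' hF0

/-- **Corollary (mean outflow + eddy spin-down).**  A door-class profile with `ω₃ ≥ 0`, mean OUTFLOW `v̄_r ≥ 0` and eddy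
SPIN-DOWN `ℛ ≤ 0` on every axis circle is poloidal. -/
theorem inner_curl_e3_eq_zero_of_outflow_spinDown (C : ℝ)
    (v : ℝ → EuclideanSpace ℝ (Fin 3) → EuclideanSpace ℝ (Fin 3))
    (hrate : HasTypeITimeDecay C v)
    (hcont : ContinuousOn (uncurry v) (Iio (0 : ℝ) ×ˢ univ))
    (hmild : ∀ s t : ℝ, s < t → t < 0 → ∀ x,
      v t x = UnboundedOperators.heatExtension (v s) (t - s) x - oseenDuhamel 1 s v v t x)
    (hdiv : ∀ t < 0, VectorCalculus.IsDivFree (v t))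
    (hsign : ∀ s < 0, ∀ y, 0 ≤ inner ℝ (curl (v s) y) (EuclideanSpace.single (2 : Fin 3) (1 : ℝ)))
    (hout : ∀ s < 0, ∀ r : ℝ, 0 < r → ∀ z : ℝ, 0 ≤ meanR v r z s)
    (hspin : ∀ s < 0, ∀ r : ℝ, 0 < r → ∀ z : ℝ, remainder v r z s ≤ 0) :
    ∀ s < 0, ∀ y, inner ℝ (curl (v s) y) (EuclideanSpace.single (2 : Fin 3) (1 : ℝ)) = 0 := by
  have hsm : IsSmoothSpaceTimeOn (Iio (0 : ℝ)) v := isSmoothSpaceTimeOn_of_class hrate hcont hmild hdiv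
  have hsign' : SignE3 v := hsign
  refine inner_curl_e3_eq_zero_of_remainder_le_outflow C v hrate hcont hmild hdiv hsign fun s hs r hr z => ?_
  have hv1 : ContDiff ℝ 1 (v s) := (hsm.contDiff_slice hs).of_le (by norm_cast)
  have hΓ : 0 ≤ circ v r z s := circ_nonneg (v := v) hv1 hsign' hs hr.le z
  have h1 : 0 ≤ (1 + r * meanR v r z s) * circ v r z s / r ^ 2 := by
    have := hout s hs r hr z
    positivity
  exact (hspin s hs r hr z).trans h1

end Summit.NavierStokesRegularity.NavierStokesRegularity.Theorems.HalfSpaceWindowDoorCirculationCarryingRigidityTimeOnlyOutflow
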